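import Mathlib
import Literature.Analysis.FluidPDE.TypeIICoreWitness
import Literature.Analysis.FluidPDE.VectorCalculus
import Literature.Analysis.Calculus.HadamardLemma
import Literature.Analysis.Calculus.CompactSupportDivergence
import Summits.NavierStokesRegularity.NavierStokesRegularity.Theorems.TypeIIInviscidRelaxationColumnarCoreExclusionDivCorrector
import HarnessLib

/-!
# Crux `ColumnarCoreExclusion` (stmt-NavierStokesRegularity-1966), line `columnar_comparison_flow`:
# the stream function of a smooth, divergence-free, columnar field (first half of step R3c — the
# cut-off / extension of the comparison datum outside the half core ball)

`--supports stmt-NavierStokesRegularity-1966` (helper file; theorems only, no definitions, no `sorry`).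

The datum of `stub_columnarComparisonFlow` produced so far (`…ColumnarCoreExclusionDivFreeDatum`:
smooth, exactly divergence free, exactly columnar, `3V/K`-close on the half ball) grows linearly at
infinity; to launch a bounded 2½-dimensional flow it must be cut off outside the half ball WITHOUT losing
`div = 0`.  The planar way is through a stream function: this file proves the **Poincaré lemma for smooth
divergence-free columnar fields on `ℝ³`** — for `w` smooth with `div w = 0` and `w(Y + τe_z) = w(Y)`, the
explicit line-integral primitive (no definitions; `ψ` enters through its defining equation `hψ`)

  `ψ Y = ∫_0^{Y₁} w(Y + (s − Y₁)e₁)₀ ds − ∫_0^{Y₀} w(s e₀)₁ ds`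

is smooth (`contDiff_stream`), columnar (`columnar_stream`), and has `∂₁ψ = w₀` (`hasDerivAt_stream_e1`,
fundamental theorem of calculus) and `∂₀ψ = −w₁` (`hasDerivAt_stream_e0`: Leibniz rule under the first
integral, `∂₀w₀ = −∂₁w₁` from `div w = 0` and `∂_z w = 0`, fundamental theorem along `e₁`, and columnarity to
match the base points `Y − Y₁e₁` and `Y₀e₀`).  So `(w₀, w₁) = (∂₁ψ, −∂₀ψ) = ∇^⊥ψ`, and any cut-off
`(∂₁(χψ), −∂₀(χψ), χw₂)` with a columnar bump `χ` stays divergence free (the sequel).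

§0 records two general line-calculus lemmas (Leibniz rule across a smooth family of base points, the
fundamental theorem along a line) and `∂_z w = 0` for columnar `w`.

WHAT THIS IS NOT: the cut-off itself, the 2½-dimensional launch, the shadowing stub.  Nothing here closes
a stub, the crux, or says anything about Navier–Stokes regularity.
-/

noncomputable section

open Literature.Analysis.FluidPDE Literature.Analysis.Calculus Set Metric MeasureTheory Real Function
open scoped RealInnerProductSpace ContDiff

namespace Summit.NavierStokesRegularity.NavierStokesRegularity.Theorems

-- the problem directory repeats the summit name (`NavierStokesRegularity/NavierStokesRegularity`)
set_option linter.dupNamespace false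

namespace ColumnarComparisonDatum

/-! ## §0 Line calculus -/

/-- **Leibniz rule across a smooth family of base points**: for smooth `g : ℝ³ → ℝ³`, a smooth curve of
base points `B`, and a direction `v`, `ε ↦ ∫_a^b g(B s + εv) ds` has derivative `∫_a^b Dg(B s) v ds` at
`ε = 0`. [folklore] -/
theorem hasDerivAt_integral_translate {g : EuclideanSpace ℝ (Fin 3) → EuclideanSpace ℝ (Fin 3)}
    (hg : ContDiff ℝ ∞ g) {B : ℝ → EuclideanSpace ℝ (Fin 3)} (hB : ContDiff ℝ ∞ B)
    (v : EuclideanSpace ℝ (Fin 3)) (a b : ℝ) :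
    HasDerivAt (fun ε : ℝ => ∫ s in a..b, g (B s + ε • v)) (∫ s in a..b, fderiv ℝ g (B s) v) 0 := by
  set F : ℝ → ℝ → EuclideanSpace ℝ (Fin 3) := fun ε s => g (B s + ε • v) with hF_def
  have hF : ContDiff ℝ ∞ (uncurry F) := by
    have hA : ContDiff ℝ ∞ fun p : ℝ × ℝ => B p.2 + p.1 • v :=
      (hB.comp contDiff_snd).add (contDiff_fst.smul contDiff_const)
    exact hg.comp hA
  have h1 : HasFDerivAt (fun ε => ∫ s in a..b, F ε s) (∫ s in a..b, partialFDerivFst F 0 s) 0 :=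
    hasFDerivAt_intervalIntegral_partialFDerivFst hF (by simp) a b 0
  have h2 : HasDerivAt (fun ε => ∫ s in a..b, F ε s) ((∫ s in a..b, partialFDerivFst F 0 s) 1) 0 :=
    h1.hasDerivAt
  have hint : IntervalIntegrable (fun s => partialFDerivFst F 0 s) volume a b :=
    ((continuous_uncurry_partialFDerivFst hF (by simp)).comp
      (Continuous.prodMk_right (0 : ℝ))).intervalIntegrable _ _
  rw [ContinuousLinearMap.intervalIntegral_apply hint] at h2
  have hid : ∀ s : ℝ, partialFDerivFst F 0 s 1 = fderiv ℝ g (B s) v := by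
    intro s
    have hline : HasDerivAt (fun ε : ℝ => B s + ε • v) v 0 := by
      simpa using ((hasDerivAt_id (0 : ℝ)).smul_const v).const_add (B s)
    have hchain : HasDerivAt (fun ε : ℝ => g (B s + ε • v)) (fderiv ℝ g (B s) v) 0 := by
      have hg' : HasFDerivAt g (fderiv ℝ g (B s + (0 : ℝ) • v)) (B s + (0 : ℝ) • v) :=
        ((hg.differentiable (by simp)) _).hasFDerivAt
      have := hg'.comp_hasDerivAt (0 : ℝ) hline
      simpa [Function.comp_def] using this
    have hpart : HasDerivAt (fun ε : ℝ => F ε s) (partialFDerivFst F 0 s 1) 0 :=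
      (hasFDerivAt_partialFDerivFst ((hF.differentiable (by simp)).differentiableAt)).hasDerivAt
    exact hpart.unique hchain
  simp_rw [hid] at h2
  exact h2

/-- **Fundamental theorem of calculus along a line**: for a `C¹` field `g`,
`∫_a^b Dg(P + (s − c)v) v ds = g(P + (b − c)v) − g(P + (a − c)v)`. [folklore] -/
theorem integral_fderiv_line_eq_sub {F : Type*} [NormedAddCommGroup F] [NormedSpace ℝ F]
    [CompleteSpace F] {g : EuclideanSpace ℝ (Fin 3) → F} (hg : ContDiff ℝ 1 g)
    (P v : EuclideanSpace ℝ (Fin 3)) (c a b : ℝ) :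
    ∫ s in a..b, fderiv ℝ g (P + (s - c) • v) v = g (P + (b - c) • v) - g (P + (a - c) • v) := by
  have hpath : ∀ s : ℝ, HasDerivAt (fun σ : ℝ => P + (σ - c) • v) v s := fun s => by
    simpa using (((hasDerivAt_id s).sub_const c).smul_const v).const_add P
  have hd : ∀ s : ℝ, HasDerivAt (fun σ : ℝ => g (P + (σ - c) • v)) (fderiv ℝ g (P + (s - c) • v) v) s :=
    fun s => ((hg.differentiable one_ne_zero) _).hasFDerivAt.comp_hasDerivAt s (hpath s)
  have hc : Continuous fun s : ℝ => fderiv ℝ g (P + (s - c) • v) v :=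
    ((hg.continuous_fderiv one_ne_zero).comp
      (continuous_const.add ((continuous_id.sub continuous_const).smul continuous_const))).clm_apply
      continuous_const
  exact intervalIntegral.integral_eq_sub_of_hasDerivAt (fun s _ => hd s) (hc.intervalIntegrable _ _)

/-- A differentiable columnar field has vanishing axial derivative: `Dw(P) e_z = 0`. [folklore] -/
theorem fderiv_eZ_eq_zero_of_columnar {w : EuclideanSpace ℝ (Fin 3) → EuclideanSpace ℝ (Fin 3)}
    (hw : Differentiable ℝ w) (hcol : IsColumnar w) (P : EuclideanSpace ℝ (Fin 3)) :
    fderiv ℝ w P eZ = 0 := by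
  have hline : HasDerivAt (fun ε : ℝ => P + ε • eZ) eZ 0 := by
    simpa using ((hasDerivAt_id (0 : ℝ)).smul_const eZ).const_add P
  have hF' : HasFDerivAt w (fderiv ℝ w (P + (0 : ℝ) • eZ)) (P + (0 : ℝ) • eZ) := by
    simpa using (hw _).hasFDerivAt
  have h1 : HasDerivAt (fun ε : ℝ => w (P + ε • eZ)) (fderiv ℝ w P eZ) 0 := by
    have := hF'.comp_hasDerivAt (0 : ℝ) hline
    simpa [Function.comp_def] using this
  have h2 : HasDerivAt (fun ε : ℝ => w (P + ε • eZ)) 0 0 := by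
    have e : (fun ε : ℝ => w (P + ε • eZ)) = fun _ => w P := funext fun ε => hcol P ε
    rw [e]; exact hasDerivAt_const _ _
  exact h1.unique h2

/-! ## §1 The stream function -/

section Stream

variable {w : EuclideanSpace ℝ (Fin 3) → EuclideanSpace ℝ (Fin 3)} {ψ : EuclideanSpace ℝ (Fin 3) → ℝ}

/-- The stream function of a smooth field is smooth (primitives with variable upper limit and
parameters). [folklore] -/
theorem contDiff_stream (hw : ContDiff ℝ ∞ w)
    (hψ : ψ = fun Y => (∫ s in (0 : ℝ)..(Y 1), w (Y + (s - Y 1) • EuclideanSpace.single 1 1) 0) -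
      ∫ s in (0 : ℝ)..(Y 0), w (s • EuclideanSpace.single 0 1) 1) : ContDiff ℝ ∞ ψ := by
  have hw0 : ContDiff ℝ ∞ fun P : EuclideanSpace ℝ (Fin 3) => w P 0 := contDiff_euclidean.1 hw 0
  have hw1 : ContDiff ℝ ∞ fun P : EuclideanSpace ℝ (Fin 3) => w P 1 := contDiff_euclidean.1 hw 1
  -- first term
  have hs : ContDiff ℝ ∞ fun q : ℝ × EuclideanSpace ℝ (Fin 3) => q.1 - q.2 1 :=
    contDiff_fst.sub (contDiff_euclidean.1 contDiff_snd (1 : Fin 3))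
  have hH : ContDiff ℝ ∞ fun q : ℝ × EuclideanSpace ℝ (Fin 3) =>
      w (q.2 + (q.1 - q.2 1) • EuclideanSpace.single 1 1) 0 :=
    hw0.comp (contDiff_snd.add (hs.smul contDiff_const))
  have hΦ := contDiff_parametric_primitive_of_contDiff
    (h := fun q : ℝ × EuclideanSpace ℝ (Fin 3) => w (q.2 + (q.1 - q.2 1) • EuclideanSpace.single 1 1) 0) hH 0
  have hι : ContDiff ℝ ∞ fun Y : EuclideanSpace ℝ (Fin 3) => ((Y 1, Y) : ℝ × EuclideanSpace ℝ (Fin 3)) :=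
    (contDiff_euclidean.1 contDiff_id (1 : Fin 3)).prodMk contDiff_id
  have h1 := hΦ.comp hι
  -- second term
  have hH' : ContDiff ℝ ∞ fun q : ℝ × EuclideanSpace ℝ (Fin 3) =>
      w (q.1 • EuclideanSpace.single 0 1) 1 :=
    hw1.comp (contDiff_fst.smul contDiff_const)
  have hΦ' := contDiff_parametric_primitive_of_contDiff
    (h := fun q : ℝ × EuclideanSpace ℝ (Fin 3) => w (q.1 • EuclideanSpace.single 0 1) 1) hH' 0
  have hι' : ContDiff ℝ ∞ fun Y : EuclideanSpace ℝ (Fin 3) => ((Y 0, Y) : ℝ × EuclideanSpace ℝ (Fin 3)) :=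
    (contDiff_euclidean.1 contDiff_id (0 : Fin 3)).prodMk contDiff_id
  have h2 := hΦ'.comp hι'
  rw [hψ]
  exact h1.sub h2

/-- The stream function of a columnar field is columnar. [folklore] -/
theorem columnar_stream (hcol : IsColumnar w)
    (hψ : ψ = fun Y => (∫ s in (0 : ℝ)..(Y 1), w (Y + (s - Y 1) • EuclideanSpace.single 1 1) 0) -
      ∫ s in (0 : ℝ)..(Y 0), w (s • EuclideanSpace.single 0 1) 1) (Y : EuclideanSpace ℝ (Fin 3)) (σ : ℝ) :
    ψ (Y + σ • eZ) = ψ Y := by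
  rw [hψ]
  dsimp only
  rw [add_smul_eZ_apply_one, add_smul_eZ_apply_zero]
  congr 1
  refine intervalIntegral.integral_congr fun s _ => ?_
  have e : Y + σ • eZ + (s - Y 1) • EuclideanSpace.single 1 1 =
      (Y + (s - Y 1) • EuclideanSpace.single 1 1) + σ • eZ := by abel
  rw [e, hcol]

/-- **`∂₁ψ = w₀`** (fundamental theorem of calculus: along `e₁` only the upper limit of the first
integral moves). [folklore] -/
theorem hasDerivAt_stream_e1 (hw : ContDiff ℝ ∞ w)
    (hψ : ψ = fun Y => (∫ s in (0 : ℝ)..(Y 1), w (Y + (s - Y 1) • EuclideanSpace.single 1 1) 0) -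
      ∫ s in (0 : ℝ)..(Y 0), w (s • EuclideanSpace.single 0 1) 1) (Y : EuclideanSpace ℝ (Fin 3)) :
    HasDerivAt (fun ε : ℝ => ψ (Y + ε • EuclideanSpace.single 1 1)) (w Y 0) 0 := by
  have hwc : Continuous w := hw.continuous
  have hre : (fun ε : ℝ => ψ (Y + ε • EuclideanSpace.single 1 1)) =
      fun ε : ℝ => (∫ s in (0 : ℝ)..(Y 1 + ε), w (Y + (s - Y 1) • EuclideanSpace.single 1 1) 0) -
        ∫ s in (0 : ℝ)..(Y 0), w (s • EuclideanSpace.single 0 1) 1 := by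
    funext ε
    rw [hψ]
    dsimp only
    have h1 : (Y + ε • EuclideanSpace.single (1 : Fin 3) (1 : ℝ)) 1 = Y 1 + ε := by simp
    have h0 : (Y + ε • EuclideanSpace.single (1 : Fin 3) (1 : ℝ)) 0 = Y 0 := by simp
    rw [h1, h0]
    congr 1
    refine intervalIntegral.integral_congr fun s _ => ?_
    dsimp only
    have e : Y + ε • EuclideanSpace.single (1 : Fin 3) (1 : ℝ) + (s - (Y 1 + ε)) • EuclideanSpace.single 1 1 =
        Y + (s - Y 1) • EuclideanSpace.single 1 1 := by
      rw [add_assoc, ← add_smul, show ε + (s - (Y 1 + ε)) = s - Y 1 by ring]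
    rw [e]
  rw [hre]
  have hG : ∀ r : ℝ, HasDerivAt
      (fun r : ℝ => ∫ s in (0 : ℝ)..r, w (Y + (s - Y 1) • EuclideanSpace.single 1 1) 0)
      (w (Y + (r - Y 1) • EuclideanSpace.single 1 1) 0) r := by
    intro r
    have hc : Continuous fun s : ℝ => w (Y + (s - Y 1) • EuclideanSpace.single 1 1) 0 :=
      (PiLp.continuous_apply 2 (fun _ : Fin 3 => ℝ) (0 : Fin 3)).comp
        (hwc.comp (continuous_const.add ((continuous_id.sub continuous_const).smul continuous_const)))
    exact intervalIntegral.integral_hasDerivAt_right (hc.intervalIntegrable _ _)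
      (hc.stronglyMeasurableAtFilter _ _) hc.continuousAt
  have := ((hG (Y 1 + 0)).comp_const_add (Y 1) 0).sub_const
    (∫ s in (0 : ℝ)..(Y 0), w (s • EuclideanSpace.single 0 1) 1)
  simpa using this

/-- **`∂₀ψ = −w₁`** for a smooth divergence-free columnar `w`: the Leibniz rule under the first integral
gives `∫_0^{Y₁} ∂₀w₀`, which is `−∫_0^{Y₁} ∂₁w₁ = −(w₁(Y) − w₁(Y − Y₁e₁))` by `div w = 0`, `∂_z w = 0` and
the fundamental theorem along `e₁`; the second integral contributes `−w₁(Y₀e₀) = −w₁(Y − Y₁e₁)`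
(columnarity). [folklore] -/
theorem hasDerivAt_stream_e0 (hw : ContDiff ℝ ∞ w) (hdiv : VectorCalculus.IsDivFree w)
    (hcol : IsColumnar w)
    (hψ : ψ = fun Y => (∫ s in (0 : ℝ)..(Y 1), w (Y + (s - Y 1) • EuclideanSpace.single 1 1) 0) -
      ∫ s in (0 : ℝ)..(Y 0), w (s • EuclideanSpace.single 0 1) 1) (Y : EuclideanSpace ℝ (Fin 3)) :
    HasDerivAt (fun ε : ℝ => ψ (Y + ε • EuclideanSpace.single 0 1)) (-(w Y 1)) 0 := by
  have hwc : Continuous w := hw.continuous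
  have hwd : Differentiable ℝ w := hw.differentiable (by simp)
  -- rewrite the two integrals along `e₀`
  have hre : (fun ε : ℝ => ψ (Y + ε • EuclideanSpace.single 0 1)) =
      fun ε : ℝ => (∫ s in (0 : ℝ)..(Y 1),
          w ((Y + (s - Y 1) • EuclideanSpace.single 1 1) + ε • EuclideanSpace.single 0 1) 0) -
        ∫ s in (0 : ℝ)..(Y 0 + ε), w (s • EuclideanSpace.single 0 1) 1 := by
    funext ε
    rw [hψ]
    dsimp only
    have h1 : (Y + ε • EuclideanSpace.single (0 : Fin 3) (1 : ℝ)) 1 = Y 1 := by simp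
    have h0 : (Y + ε • EuclideanSpace.single (0 : Fin 3) (1 : ℝ)) 0 = Y 0 + ε := by simp
    rw [h1, h0]
    congr 1
    refine intervalIntegral.integral_congr fun s _ => ?_
    dsimp only
    have e : Y + ε • EuclideanSpace.single (0 : Fin 3) (1 : ℝ) + (s - Y 1) • EuclideanSpace.single 1 1 =
        Y + (s - Y 1) • EuclideanSpace.single 1 1 + ε • EuclideanSpace.single 0 1 := by abel
    rw [e]
  rw [hre]
  -- first integral: Leibniz rule, then the component `0`
  have hB : ContDiff ℝ ∞ fun s : ℝ => Y + (s - Y 1) • EuclideanSpace.single (1 : Fin 3) (1 : ℝ) :=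
    contDiff_const.add ((contDiff_id.sub contDiff_const).smul contDiff_const)
  have hL := hasDerivAt_integral_translate hw hB (EuclideanSpace.single 0 1) 0 (Y 1)
  have hL0 : HasDerivAt (fun ε : ℝ => ∫ s in (0 : ℝ)..(Y 1),
      w ((Y + (s - Y 1) • EuclideanSpace.single 1 1) + ε • EuclideanSpace.single 0 1) 0)
      ((∫ s in (0 : ℝ)..(Y 1), fderiv ℝ w (Y + (s - Y 1) • EuclideanSpace.single 1 1)
        (EuclideanSpace.single 0 1)) 0) 0 := by
    have hcont : Continuous fun s : ℝ =>
        w ((Y + (s - Y 1) • EuclideanSpace.single 1 1) + (0 : ℝ) • EuclideanSpace.single 0 1) :=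
      hwc.comp (hB.continuous.add continuous_const)
    have hcomm : ∀ ε : ℝ, (∫ s in (0 : ℝ)..(Y 1),
        w ((Y + (s - Y 1) • EuclideanSpace.single 1 1) + ε • EuclideanSpace.single 0 1)) 0 =
        ∫ s in (0 : ℝ)..(Y 1),
          w ((Y + (s - Y 1) • EuclideanSpace.single 1 1) + ε • EuclideanSpace.single 0 1) 0 := by
      intro ε
      have hc : Continuous fun s : ℝ =>
          w ((Y + (s - Y 1) • EuclideanSpace.single 1 1) + ε • EuclideanSpace.single 0 1) :=
        hwc.comp (hB.continuous.add continuous_const)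
      have := ((EuclideanSpace.proj (0 : Fin 3)).intervalIntegral_comp_comm
        (hc.intervalIntegrable (μ := volume) 0 (Y 1))).symm
      simpa using this
    have := (EuclideanSpace.proj (0 : Fin 3)).hasFDerivAt.comp_hasDerivAt (0 : ℝ) hL
    simp only [Function.comp_def] at this
    simp_rw [← hcomm]
    simpa using this
  -- the integrand: `∂₀w₀ = -∂₁w₁` along the segment
  have hpt : ∀ s : ℝ, fderiv ℝ w (Y + (s - Y 1) • EuclideanSpace.single 1 1) (EuclideanSpace.single 0 1) 0 =
      -(fderiv ℝ w (Y + (s - Y 1) • EuclideanSpace.single 1 1) (EuclideanSpace.single 1 1) 1) := by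
    intro s
    have h := hdiv (Y + (s - Y 1) • EuclideanSpace.single 1 1)
    rw [divergence_eq_sum_three, fderiv_eZ_eq_zero_of_columnar hwd hcol] at h
    simp only [PiLp.zero_apply, add_zero] at h
    linarith
  have hcontD : ∀ v : EuclideanSpace ℝ (Fin 3), Continuous fun s : ℝ =>
      fderiv ℝ w (Y + (s - Y 1) • EuclideanSpace.single 1 1) v := fun v =>
    ((hw.continuous_fderiv (by simp)).comp hB.continuous).clm_apply continuous_const
  have hcomp1 : (∫ s in (0 : ℝ)..(Y 1), fderiv ℝ w (Y + (s - Y 1) • EuclideanSpace.single 1 1)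
      (EuclideanSpace.single 0 1)) 0 =
      -((∫ s in (0 : ℝ)..(Y 1), fderiv ℝ w (Y + (s - Y 1) • EuclideanSpace.single 1 1)
        (EuclideanSpace.single 1 1)) 1) := by
    have e0 := ((EuclideanSpace.proj (0 : Fin 3)).intervalIntegral_comp_comm
      ((hcontD (EuclideanSpace.single 0 1)).intervalIntegrable (μ := volume) 0 (Y 1))).symm
    have e1 := ((EuclideanSpace.proj (1 : Fin 3)).intervalIntegral_comp_comm
      ((hcontD (EuclideanSpace.single 1 1)).intervalIntegrable (μ := volume) 0 (Y 1))).symm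
    simp only [PiLp.proj_apply] at e0 e1
    rw [e0, e1, ← intervalIntegral.integral_neg]
    exact intervalIntegral.integral_congr fun s _ => hpt s
  -- fundamental theorem along `e₁`
  have hftc : (∫ s in (0 : ℝ)..(Y 1), fderiv ℝ w (Y + (s - Y 1) • EuclideanSpace.single 1 1)
      (EuclideanSpace.single 1 1)) 1 = w Y 1 - w (Y + (0 - Y 1) • EuclideanSpace.single 1 1) 1 := by
    rw [integral_fderiv_line_eq_sub (hw.of_le (mod_cast le_top))]
    simp
  -- second integral
  have hc2 : Continuous fun s : ℝ => w (s • EuclideanSpace.single (0 : Fin 3) (1 : ℝ)) 1 :=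
    (PiLp.continuous_apply 2 (fun _ : Fin 3 => ℝ) (1 : Fin 3)).comp
      (hwc.comp (continuous_id.smul continuous_const))
  have hG : ∀ r : ℝ, HasDerivAt (fun r : ℝ => ∫ s in (0 : ℝ)..r, w (s • EuclideanSpace.single 0 1) 1)
      (w (r • EuclideanSpace.single 0 1) 1) r := fun r =>
    intervalIntegral.integral_hasDerivAt_right (hc2.intervalIntegrable _ _)
      (hc2.stronglyMeasurableAtFilter _ _) hc2.continuousAt
  have h2 : HasDerivAt (fun ε : ℝ => ∫ s in (0 : ℝ)..(Y 0 + ε), w (s • EuclideanSpace.single 0 1) 1)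
      (w ((Y 0) • EuclideanSpace.single 0 1) 1) 0 := by
    simpa using (hG (Y 0 + 0)).comp_const_add (Y 0) 0
  -- the base points `Y - Y₁e₁` and `Y₀e₀` differ by a vertical translation
  have hbase : w (Y + (0 - Y 1) • EuclideanSpace.single 1 1) = w ((Y 0) • EuclideanSpace.single 0 1) := by
    have e : Y + (0 - Y 1) • EuclideanSpace.single (1 : Fin 3) (1 : ℝ) =
        (Y 0) • EuclideanSpace.single 0 1 + (Y 2) • eZ := by
      ext i
      fin_cases i <;> simp [eZ]
    rw [e, hcol]
  have hsum := hL0.sub h2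
  rw [hcomp1, hftc, hbase] at hsum
  exact hsum.congr_deriv (by ring)

end Stream

end ColumnarComparisonDatum

end Summit.NavierStokesRegularity.NavierStokesRegularity.Theorems

end
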